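import Summits.Ventures.LatticeQCDFlow.Scoring.LaplaceTorusLemmas
import Summits.Ventures.LatticeQCDFlow.Scoring.UNOnePlaquetteBesselDeterminant
import Mathlib.MeasureTheory.Measure.Haar.NormedSpace
import HarnessLib

/-!
# Laplace's method on Weyl's torus, II — THE WEAK-COUPLING LAW OF THE `U(N)` ONE-PLAQUETTE PARTITION FUNCTION FOR EVERY `N`: `det[I_{|i−j|}(x)]_{N×N} · e^{−Nx} · x^{N²/2} → M_N / ((2π)^N N!)`, `M_N = ∫_{ℝ^N} e^{−|φ|²/2} Π_{j≺k} (φ_j − φ_k)² dφ > 0`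

HONEST FRAMING: exact (Metropolis-corrected) sampling algorithms for lattice gauge theory;
figures of merit are autocorrelation/cost numbers at stated couplings and volumes; no
continuum-physics claim.

Venture `LatticeQCDFlow` (cell pub-lqcd), sub-topic `Scoring`; FANOUT row 5 (`s0-sun-a`), GEN-20.
NEW WORK of the cell (placement rule).  GEN-17's `BesselToeplitzAndreief` / `UNOnePlaquetteBesselDeterminant` typed
`Z_N(x) = ∫_{U(N)} e^{x Re tr U} dU = det[I_{|i−j|}(x)]_{N×N} = ((2π)^N N!)⁻¹ ∫_{(−π,π]^N} e^{xΣ_b cos θ_b} Π_{j≺k}|e^{iθ_j} − e^{iθ_k}|² dθ`.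
Here: ITS WEAK-COUPLING (`x → ∞`) LAW FOR EVERY `N`, by Laplace's method — substitute `θ = φ/√x` (additive Haar
change of variables on `ℝ^N`), dominate by the integrable Gaussian-times-polynomial of part I, and let `x → ∞`
(dominated convergence):

* §1 `torusIntegrand_eq`, `scaledIntegrand_eq_mul`, **`integral_scaledIntegrand_eq`** — for `x > 0`,
  `∫_{ℝ^N} 1[φ/√x ∈ (−π,π]^N] e^{Σ_b x(cos(φ_b/√x)−1)} Π_{j≺k} 2x(1−cos((φ_j−φ_k)/√x)) dφ
   = e^{−Nx} x^{|OD|} √x^{N} · ∫_{(−π,π]^N} e^{xΣcos θ_b} Π|e^{iθ_j} − e^{iθ_k}|² dθ` (`Measure.integral_comp_smul`);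
* §2 `scaledIntegrand_le_bound`, `tendsto_scaledIntegrand` (pointwise limit `e^{−Σφ_b²/2} Π(φ_j − φ_k)²`),
  **`tendsto_integral_scaledIntegrand`** (dominated convergence), **`gaussVandermonde_pos`** (`M_N > 0`: a continuous
  non-negative integrand, non-zero at `φ_b = enum b`, on an open-positive measure);
* §3 **`tendsto_det_besselI_toeplitz_enum_weakCoupling`** (any finite index type) and
  **`tendsto_det_besselI_toeplitz_weakCoupling`**: for every `N`,
  `det[I_{|i−j|}(x)]_{i,j<N} · e^{−Nx} · √x^{N²} → M_N / ((2π)^N · N!)` as `x → ∞` — equivalently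
  `Z_N(x) ~ (M_N/((2π)^N N!)) e^{Nx} x^{−N²/2}`: `N²/2 = dim U(N)/2` Gaussian modes.

`M_N` is Mehta's integral `(2π)^{N/2} Π_{j=1}^{N} j!` (Selberg; Hermite orthogonality) — that closed form is NOT proved
here (`-- TODO(general form)`); with it the limit is `(2π)^{−N/2} Π_{j=1}^{N−1} j!` (Gross–Witten weak coupling at
finite `N`).  The sibling `UNFreeEnergyWeakCoupling2D` turns this into `f_N(β) + (N²/2) log β → log M_N − N log 2π − log N!`
for the two-dimensional `U(N)` free energy density.  No `def`, nothing cited as a fact, 0 sorry.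
-/

noncomputable section

open Real MeasureTheory Filter Topology Finset
open Complex (I)
open Literature.Analysis.FunctionSpaces (besselI)
open Literature.RepresentationTheory.CompactGroups.WeylIntegration (OD enum)

namespace Summit.Ventures.LatticeQCDFlow.Scoring

/-! ### 1. The scaled integrand and the change of variables `θ = φ/√x` -/

section Laplace

variable {n : Type*} [Fintype n]

/-- The tree's torus integrand `e^{x Σ_b cos θ_b} Π_{j≺k} |e^{iθ_j} − e^{iθ_k}|²` in real-trigonometric form. -/
theorem torusIntegrand_eq (x : ℝ) (θ : n → ℝ) :
    Real.exp (x * ∑ b, Real.cos (θ b)) * ∏ p : OD n, ‖Complex.exp (θ p.1.1 * I) - Complex.exp (θ p.1.2 * I)‖ ^ 2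
      = Real.exp (x * ∑ b, Real.cos (θ b)) * ∏ p : OD n, (2 - 2 * Real.cos (θ p.1.1 - θ p.1.2)) := by
  congr 1
  exact Finset.prod_congr rfl fun p _ => norm_cexp_sub_cexp_sq _ _

/-- The scaled integrand at `φ` with `φ/√x ∈ (−π,π]^N` IS `e^{−Nx} x^{|OD|}` times the torus integrand at `θ = φ/√x`
(`x > 0`): `e^{Σ_b x(cos(φ_b/√x) − 1)} Π_{j≺k} 2x(1 − cos((φ_j − φ_k)/√x)) = e^{−Nx} x^{|OD|} · e^{xΣcos θ} Π(2 − 2cos(θ_j − θ_k))`. -/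
theorem scaledIntegrand_eq_mul (x : ℝ) (φ : n → ℝ) :
    Real.exp (∑ b, x * (Real.cos (φ b / √x) - 1)) * ∏ p : OD n, (2 * x * (1 - Real.cos ((φ p.1.1 - φ p.1.2) / √x)))
      = Real.exp (-(Fintype.card n * x)) * x ^ Fintype.card (OD n) *
        (Real.exp (x * ∑ b, Real.cos ((fun b => φ b / √x) b)) *
          ∏ p : OD n, (2 - 2 * Real.cos ((fun b => φ b / √x) p.1.1 - (fun b => φ b / √x) p.1.2))) := by
  have hexp : Real.exp (∑ b, x * (Real.cos (φ b / √x) - 1))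
      = Real.exp (-(Fintype.card n * x)) * Real.exp (x * ∑ b, Real.cos (φ b / √x)) := by
    rw [← Real.exp_add]
    congr 1
    simp only [mul_sub, mul_one, Finset.sum_sub_distrib, Finset.sum_const, Finset.card_univ, nsmul_eq_mul,
      Finset.mul_sum]
    ring
  have hprod : ∏ p : OD n, (2 * x * (1 - Real.cos ((φ p.1.1 - φ p.1.2) / √x)))
      = x ^ Fintype.card (OD n) * ∏ p : OD n, (2 - 2 * Real.cos (φ p.1.1 / √x - φ p.1.2 / √x)) := by
    have hc : ∏ _p : OD n, x = x ^ Fintype.card (OD n) := by rw [Finset.prod_const, Finset.card_univ]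
    rw [← hc, ← Finset.prod_mul_distrib]
    refine Finset.prod_congr rfl fun p _ => ?_
    rw [sub_div]
    ring
  rw [hexp, hprod]
  ring

/-- **Change of variables `θ = φ/√x` on `ℝ^N`** (`Measure.integral_comp_smul` for the additive Haar measure `volume`
on `n → ℝ`, scaling factor `(√x)⁻¹`, `|n| = N`): for `x > 0`,
`∫_{ℝ^N} 1[φ/√x ∈ (−π,π]^N] e^{Σ x(cos(φ_b/√x)−1)} Π 2x(1−cos((φ_j−φ_k)/√x)) dφ
 = e^{−Nx} x^{|OD|} √x^{N} ∫_{(−π,π]^N} e^{xΣcos θ_b} Π|e^{iθ_j} − e^{iθ_k}|² dθ`. -/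
theorem integral_scaledIntegrand_eq {x : ℝ} (hx : 0 < x) :
    ∫ φ : n → ℝ, ((fun φ : n → ℝ => fun b => φ b / √x) ⁻¹' Set.univ.pi fun _ => Set.Ioc (-π) π).indicator
        (fun φ => Real.exp (∑ b, x * (Real.cos (φ b / √x) - 1)) *
          ∏ p : OD n, (2 * x * (1 - Real.cos ((φ p.1.1 - φ p.1.2) / √x)))) φ
      = Real.exp (-(Fintype.card n * x)) * x ^ Fintype.card (OD n) * √x ^ Fintype.card n *
        ∫ θ, Real.exp (x * ∑ b, Real.cos (θ b)) *
            ∏ p : OD n, ‖Complex.exp (θ p.1.1 * I) - Complex.exp (θ p.1.2 * I)‖ ^ 2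
          ∂(Measure.pi fun _ : n => (volume : Measure ℝ).restrict (Set.Ioc (-π) π)) := by
  have hsx : 0 < √x := Real.sqrt_pos.2 hx
  set c : ℝ := (√x)⁻¹ with hc
  have hc0 : 0 < c := inv_pos.2 hsx
  -- the torus integral as an integral over `ℝ^N` of an indicator
  set F : (n → ℝ) → ℝ := fun θ => Real.exp (x * ∑ b, Real.cos (θ b)) *
    ∏ p : OD n, (2 - 2 * Real.cos (θ p.1.1 - θ p.1.2)) with hF
  set cube : Set (n → ℝ) := Set.univ.pi fun _ => Set.Ioc (-π) π with hcube
  have hcube_meas : MeasurableSet cube := MeasurableSet.univ_pi fun _ => measurableSet_Ioc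
  have htorus : ∫ θ, Real.exp (x * ∑ b, Real.cos (θ b)) *
        ∏ p : OD n, ‖Complex.exp (θ p.1.1 * I) - Complex.exp (θ p.1.2 * I)‖ ^ 2
        ∂(Measure.pi fun _ : n => (volume : Measure ℝ).restrict (Set.Ioc (-π) π))
      = ∫ θ : n → ℝ, cube.indicator F θ := by
    simp_rw [torusIntegrand_eq]
    rw [← Measure.restrict_pi_pi, ← volume_pi, integral_indicator hcube_meas]
  -- the scaling `φ ↦ c • φ`
  have hscale : ∀ φ : n → ℝ, (fun b => φ b / √x) = c • φ := by
    intro φ; funext b; simp [hc, div_eq_inv_mul]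
  have hind : ∀ φ : n → ℝ,
      ((fun φ : n → ℝ => fun b => φ b / √x) ⁻¹' cube).indicator
        (fun φ => Real.exp (∑ b, x * (Real.cos (φ b / √x) - 1)) *
          ∏ p : OD n, (2 * x * (1 - Real.cos ((φ p.1.1 - φ p.1.2) / √x)))) φ
      = Real.exp (-(Fintype.card n * x)) * x ^ Fintype.card (OD n) * (cube.indicator F) (c • φ) := by
    intro φ
    by_cases hφ : (fun b => φ b / √x) ∈ cube
    · rw [Set.indicator_of_mem (show φ ∈ (fun φ : n → ℝ => fun b => φ b / √x) ⁻¹' cube from hφ),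
        Set.indicator_of_mem (show c • φ ∈ cube by rwa [← hscale]), scaledIntegrand_eq_mul, hF, hscale]
    · rw [Set.indicator_of_notMem (show φ ∉ (fun φ : n → ℝ => fun b => φ b / √x) ⁻¹' cube from hφ),
        Set.indicator_of_notMem (show c • φ ∉ cube by rwa [← hscale]), mul_zero]
  simp_rw [hind]
  rw [integral_const_mul, Measure.integral_comp_smul volume (cube.indicator F) c, htorus,
    Module.finrank_fintype_fun_eq_card, smul_eq_mul]
  have hcN : |(c ^ Fintype.card n)⁻¹| = √x ^ Fintype.card n := by
    rw [hc, inv_pow, inv_inv, abs_of_pos (pow_pos hsx _)]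
  rw [hcN]
  ring

/-! ### 2. Dominated convergence -/

/-- Domination on the cube: for `x > 0` and `φ/√x ∈ (−π,π]^N`,
`e^{Σ x(cos(φ_b/√x)−1)} Π_{j≺k} 2x(1−cos((φ_j−φ_k)/√x)) ≤ 2^{|OD|} Π_b e^{−(2/π²)φ_b²}(1 + φ_b²)^{|OD|}`. -/
theorem scaledIntegrand_le_bound {x : ℝ} (hx : 0 < x) {φ : n → ℝ}
    (hφ : ∀ b, φ b / √x ∈ Set.Ioc (-π) π) :
    Real.exp (∑ b, x * (Real.cos (φ b / √x) - 1)) * ∏ p : OD n, (2 * x * (1 - Real.cos ((φ p.1.1 - φ p.1.2) / √x)))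
      ≤ 2 ^ Fintype.card (OD n) * ∏ b, (Real.exp (-(2 / π ^ 2 * φ b ^ 2)) * (1 + φ b ^ 2) ^ Fintype.card (OD n)) := by
  refine mul_prod_le_laplaceBound φ ?_ (fun p => pairFactor_nonneg hx.le _)
    fun p => pairFactor_le_sq hx _
  rw [← Real.exp_sum]
  refine Real.exp_le_exp.2 (Finset.sum_le_sum fun b _ => mul_cos_div_sqrt_sub_one_le hx ?_)
  rw [abs_le]
  exact ⟨(hφ b).1.le, (hφ b).2⟩

/-- Pointwise limit of the scaled integrand: for every `φ ∈ ℝ^N`,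
`1[φ/√x ∈ (−π,π]^N] e^{Σ x(cos(φ_b/√x)−1)} Π 2x(1−cos((φ_j−φ_k)/√x)) → e^{−Σφ_b²/2} Π (φ_j − φ_k)²` as `x → ∞`. -/
theorem tendsto_scaledIntegrand (φ : n → ℝ) :
    Tendsto (fun x : ℝ => ((fun φ : n → ℝ => fun b => φ b / √x) ⁻¹' Set.univ.pi fun _ => Set.Ioc (-π) π).indicator
        (fun φ => Real.exp (∑ b, x * (Real.cos (φ b / √x) - 1)) *
          ∏ p : OD n, (2 * x * (1 - Real.cos ((φ p.1.1 - φ p.1.2) / √x)))) φ)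
      atTop (𝓝 (Real.exp (∑ b, -(φ b ^ 2 / 2)) * ∏ p : OD n, (φ p.1.1 - φ p.1.2) ^ 2)) := by
  -- the limit without the indicator
  have hlim : Tendsto (fun x : ℝ => Real.exp (∑ b, x * (Real.cos (φ b / √x) - 1)) *
      ∏ p : OD n, (2 * x * (1 - Real.cos ((φ p.1.1 - φ p.1.2) / √x)))) atTop
      (𝓝 (Real.exp (∑ b, -(φ b ^ 2 / 2)) * ∏ p : OD n, (φ p.1.1 - φ p.1.2) ^ 2)) := by
    refine Tendsto.mul ?_ ?_
    · exact (Real.continuous_exp.tendsto _).comp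
        (tendsto_finsetSum _ fun b _ => tendsto_mul_cos_div_sqrt_sub_one (φ b))
    · exact tendsto_finsetProd _ fun p _ => tendsto_pairFactor (φ p.1.1) (φ p.1.2)
  -- eventually `φ/√x` lies in the cube
  have hmem : ∀ᶠ x : ℝ in atTop, (fun b => φ b / √x) ∈ Set.univ.pi fun _ : n => Set.Ioc (-π) π := by
    have hM : ∀ᶠ x : ℝ in atTop, ∀ b, |φ b| < π * √x := by
      have hsqrt : Tendsto (fun x : ℝ => π * √x) atTop atTop :=
        (Real.tendsto_sqrt_atTop).const_mul_atTop Real.pi_pos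
      have h1 : ∀ b, ∀ᶠ x : ℝ in atTop, |φ b| < π * √x := fun b => hsqrt.eventually_gt_atTop _
      exact Filter.eventually_all.2 h1
    filter_upwards [hM, eventually_gt_atTop (0 : ℝ)] with x hx hx0
    have hs : 0 < √x := Real.sqrt_pos.2 hx0
    intro b _
    have hb := hx b
    rw [abs_lt] at hb
    constructor
    · rw [lt_div_iff₀ hs]; linarith
    · rw [div_le_iff₀ hs]; linarith
  refine hlim.congr' ?_
  filter_upwards [hmem] with x hx
  rw [Set.indicator_of_mem (show φ ∈ (fun φ : n → ℝ => fun b => φ b / √x) ⁻¹'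
    Set.univ.pi fun _ => Set.Ioc (-π) π from hx)]

/-- **`∫_{ℝ^N} G_x dφ → M_N = ∫_{ℝ^N} e^{−|φ|²/2} Π_{j≺k}(φ_j − φ_k)² dφ`** as `x → ∞` (dominated convergence). -/
theorem tendsto_integral_scaledIntegrand :
    Tendsto (fun x : ℝ => ∫ φ : n → ℝ,
        ((fun φ : n → ℝ => fun b => φ b / √x) ⁻¹' Set.univ.pi fun _ => Set.Ioc (-π) π).indicator
          (fun φ => Real.exp (∑ b, x * (Real.cos (φ b / √x) - 1)) *
            ∏ p : OD n, (2 * x * (1 - Real.cos ((φ p.1.1 - φ p.1.2) / √x)))) φ)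
      atTop (𝓝 (∫ φ : n → ℝ, Real.exp (∑ b, -(φ b ^ 2 / 2)) * ∏ p : OD n, (φ p.1.1 - φ p.1.2) ^ 2)) := by
  refine tendsto_integral_filter_of_dominated_convergence _ ?_ ?_ integrable_laplaceBound
    (Eventually.of_forall tendsto_scaledIntegrand)
  · filter_upwards [eventually_gt_atTop (0 : ℝ)] with x hx
    refine AEStronglyMeasurable.indicator ?_ ?_
    · exact (by fun_prop : Continuous fun φ : n → ℝ => Real.exp (∑ b, x * (Real.cos (φ b / √x) - 1)) *
        ∏ p : OD n, (2 * x * (1 - Real.cos ((φ p.1.1 - φ p.1.2) / √x)))).aestronglyMeasurable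
    · exact (MeasurableSet.univ_pi fun _ => measurableSet_Ioc).preimage (by fun_prop)
  · filter_upwards [eventually_gt_atTop (0 : ℝ)] with x hx
    refine Eventually.of_forall fun φ => ?_
    rw [Real.norm_eq_abs]
    by_cases hφ : φ ∈ (fun φ : n → ℝ => fun b => φ b / √x) ⁻¹' Set.univ.pi fun _ => Set.Ioc (-π) π
    · rw [Set.indicator_of_mem hφ, abs_of_nonneg (mul_nonneg (Real.exp_nonneg _)
        (Finset.prod_nonneg fun p _ => pairFactor_nonneg hx.le _))]
      exact scaledIntegrand_le_bound hx fun b => hφ b (Set.mem_univ _)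
    · rw [Set.indicator_of_notMem hφ, abs_zero]
      exact mul_nonneg (by positivity) (Finset.prod_nonneg fun b _ => by positivity)

/-- **Mehta's integrand is positive on a set of positive measure: `M_N > 0`.** -/
theorem gaussVandermonde_pos :
    0 < ∫ φ : n → ℝ, Real.exp (∑ b, -(φ b ^ 2 / 2)) * ∏ p : OD n, (φ p.1.1 - φ p.1.2) ^ 2 := by
  have hcont : Continuous fun φ : n → ℝ => Real.exp (∑ b, -(φ b ^ 2 / 2)) * ∏ p : OD n, (φ p.1.1 - φ p.1.2) ^ 2 := by
    fun_prop
  have hnn : 0 ≤ fun φ : n → ℝ => Real.exp (∑ b, -(φ b ^ 2 / 2)) * ∏ p : OD n, (φ p.1.1 - φ p.1.2) ^ 2 :=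
    fun φ => mul_nonneg (Real.exp_nonneg _) (Finset.prod_nonneg fun p _ => sq_nonneg _)
  -- integrable: dominated by the Laplace bound of part I (`e^{−t²/2} ≤ e^{−(2/π²)t²}` as `2/π² ≤ 1/2`)
  have hint : Integrable (fun φ : n → ℝ => Real.exp (∑ b, -(φ b ^ 2 / 2)) * ∏ p : OD n, (φ p.1.1 - φ p.1.2) ^ 2) := by
    refine Integrable.mono' integrable_laplaceBound hcont.aestronglyMeasurable (Eventually.of_forall fun φ => ?_)
    rw [Real.norm_eq_abs, abs_of_nonneg (hnn φ)]
    refine mul_prod_le_laplaceBound φ ?_ (fun p => sq_nonneg _) fun p => le_rfl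
    rw [← Real.exp_sum]
    refine Real.exp_le_exp.2 (Finset.sum_le_sum fun b _ => ?_)
    have hπ : 2 / π ^ 2 ≤ 1 / 2 := by
      rw [div_le_div_iff₀ (by positivity) (by norm_num)]
      nlinarith [Real.pi_gt_three]
    nlinarith [sq_nonneg (φ b)]
  rw [integral_pos_iff_support_of_nonneg hnn hint]
  -- the support contains the open set where all coordinates are distinct, which contains `φ⁰_b = enum b`
  have hopen : IsOpen (Function.support fun φ : n → ℝ =>
      Real.exp (∑ b, -(φ b ^ 2 / 2)) * ∏ p : OD n, (φ p.1.1 - φ p.1.2) ^ 2) :=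
    hcont.isOpen_support
  refine hopen.measure_pos volume ⟨fun b => (enum n b : ℝ), ?_⟩
  rw [Function.mem_support]
  refine mul_ne_zero (Real.exp_pos _).ne' (Finset.prod_ne_zero_iff.2 fun p _ => pow_ne_zero _ (sub_ne_zero.2 ?_))
  have hp := p.2
  intro h
  have h' : ((enum n p.1.1 : ℕ) : ℝ) = ((enum n p.1.2 : ℕ) : ℝ) := h
  exact (ne_of_lt hp) (Fin.ext (by exact_mod_cast h'))

end Laplace

/-! ### 3. The weak-coupling law of `det[I_{|i−j|}(x)]_{N×N}` -/

section Final

variable {n : Type*} [Fintype n] [DecidableEq n]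

/-- The weak-coupling law for a general finite index type `n` (`|n| = N`, determinant indexed through `enum n`):
`det[I_{|i−j|}(x)] · e^{−Nx} · √x^{N²} → M_n / ((2π)^N N!)`. -/
theorem tendsto_det_besselI_toeplitz_enum_weakCoupling :
    Tendsto (fun x : ℝ => (Matrix.of fun i j : n =>
        besselI (((enum n i : ℕ) : ℤ) - ((enum n j : ℕ) : ℤ)).natAbs x).det *
        Real.exp (-(Fintype.card n * x)) * √x ^ (Fintype.card n ^ 2)) atTop
      (𝓝 ((∫ φ : n → ℝ, Real.exp (∑ b, -(φ b ^ 2 / 2)) * ∏ p : OD n, (φ p.1.1 - φ p.1.2) ^ 2) /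
        ((2 * π) ^ Fintype.card n * (Fintype.card n).factorial))) := by
  have hlim := (tendsto_integral_scaledIntegrand (n := n)).div_const
    ((2 * π) ^ Fintype.card n * (Fintype.card n).factorial)
  refine hlim.congr' ?_
  filter_upwards [eventually_gt_atTop (0 : ℝ)] with x hx
  have hK : (0 : ℝ) < (2 * π) ^ Fintype.card n * (Fintype.card n).factorial := by positivity
  rw [integral_scaledIntegrand_eq hx, integral_cube_exp_mul_sum_cos_mul_prod_norm_sub_sq]
  -- `√x^{N²} = x^{|OD|} √x^{N}`
  have hpow : √x ^ (Fintype.card n ^ 2) = x ^ Fintype.card (OD n) * √x ^ Fintype.card n := by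
    rw [← card_add_two_mul_card_OD (n := n), pow_add, pow_mul, Real.sq_sqrt hx.le, mul_comm]
  rw [hpow]
  field_simp

end Final

/-- **THE WEAK-COUPLING LAW OF THE `U(N)` ONE-PLAQUETTE PARTITION FUNCTION, EVERY `N`** (Laplace's method on Weyl's
torus): as `x → ∞`,
`det[I_{|i−j|}(x)]_{i,j<N} · e^{−Nx} · √x^{N²} → M_N / ((2π)^N · N!)`,
`M_N = ∫_{ℝ^N} e^{−Σφ_b²/2} Π_{j≺k} (φ_j − φ_k)² dφ > 0` (`gaussVandermonde_pos`); i.e.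
`Z_N(x) = ∫_{U(N)} e^{x Re tr U} dU ~ (M_N/((2π)^N N!)) · e^{Nx} x^{−N²/2}`. -/
theorem tendsto_det_besselI_toeplitz_weakCoupling (N : ℕ) :
    Tendsto (fun x : ℝ => (Matrix.of fun i j : Fin N => besselI ((i : ℤ) - (j : ℤ)).natAbs x).det *
        Real.exp (-(N * x)) * √x ^ (N ^ 2)) atTop
      (𝓝 ((∫ φ : Fin N → ℝ, Real.exp (∑ b, -(φ b ^ 2 / 2)) * ∏ p : OD (Fin N), (φ p.1.1 - φ p.1.2) ^ 2) /
        ((2 * π) ^ N * N.factorial))) := by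
  have h := tendsto_det_besselI_toeplitz_enum_weakCoupling (n := Fin N)
  simp only [det_besselI_toeplitz_enum_eq, det_besselI_toeplitz_fin_card, Fintype.card_fin] at h
  exact h

-- TODO(general form): Mehta's integral `M_N = (2π)^{N/2} Π_{j=1}^{N} j!`, whence
--   `det[I_{|i−j|}(x)] e^{−Nx} √x^{N²} → (2π)^{−N/2} Π_{j=1}^{N−1} j!` (Gross–Witten weak coupling at finite `N`).

end Summit.Ventures.LatticeQCDFlow.Scoring
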